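/-
Copyright (c) 2026 the pub-hodgecm-mathlib formalisation cell (harness21).  Prover seat hodgecm-mathlib-K2E3-p23 (g6), HCML Track B «K2-LIT» ∕ h413
(`stmt-HodgeConjecture-24833`), line `K2_E3_EllipticInputs`, road «GL₂-sc» (road owner K2E5-p17 (g5), dealer K2E3-plan (g4)), NON-ELLIPTIC half, brick 2N-7,
FILE 4 OF 4 — THE LEAF `hNE₂` = the hosted sub-socket (S-C′-GL₂sc-NE) `U12Characters.sig_K2E3GL2ModUniformizerNonEllEstimates` (U12 ED. 26), statement bytes VERBATIM
(BRICK LIST «GL₂-sc» v1.1 §1), sorry-free.  2026-09-04.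
-/
import Summits.HodgeConjecture.HodgeConjecture.Theorems.K2E3GL2ModUniformizerNonEllEstimatesOfWeight   -- ★ 2N-7 F3 (this seat): `nonEllEstimates_of_weight` (the leaf body modulo `hΦ`)
import Summits.HodgeConjecture.HodgeConjecture.Theorems.K2E3GL2NonEllWeightLocIntegrable              -- ★ 2N-6 p859111 (K2E3-p24 g0): `locallyIntegrable_indicator_not_isCompact_centralizer_rpow_neg` (`hΦ`)
import Summits.HodgeConjecture.HodgeConjecture.Theorems.K2E3GL2HeightBallExhaustion                    -- ★ 2N-0a p858793 (this seat): `exists_adHeightBall_compactExhaustion_quotScalar`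
import HarnessLib

/-!
# Road «GL₂-sc», non-elliptic half, brick 2N-7 (file 4 of 4): THE LEAF `hNE₂` — Harish-Chandra's non-elliptic estimates for the truncated conjugation averages of a
# supercuspidal matrix coefficient on `G' = GL₂(F) ⧸ ϖ^ℤ` (Part VII §3, Theorems 15, 18–20): `∃ Ω Fl M, (a.e. convergence off the elliptic set) ∧ (a.e. domination) ∧ M ∈ L¹_loc`

Cell `pub/hodgecm-mathlib` (D-0151), Track B «K2-LIT», crux H413 = `stmt-HodgeConjecture-24833`, route of record `HCCMUnconditional`.  Lane
`--supports stmt-HodgeConjecture-24833 --as helper`; THEOREMS ONLY (no `def`, no `instance`, no `notation`, no named-fact hypothesis, no `sorry`); count-neutral.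
The TYPE of `nonEllEstimates_modUniformizer` is BRICK LIST «GL₂-sc» v1.1 §1 (K2E5-p17 (g5)) = the hosted sub-socket `Cruxes/H413/Lines/K2_E3_EllipticInputsSigs_U12Characters.lean`
(S-C′-GL₂sc-NE) `sig_K2E3GL2ModUniformizerNonEllEstimates` (U12 ED. 26, dealer K2E3-plan (g4)) = hypothesis `hNE₂` of ★ (2A-2) ED. 2
`K2E3GL2SupercuspidalCharLocInt.charLocIntNear_gl2_supercuspidal_of_nonell` token for token, so the dealer's tie is `:= nonEllEstimates_modUniformizer`.
PROOF: Borel structures on `F`, `GL₂(F)` chosen inside; `Ω` = ★ 2N-0a `exists_adHeightBall_compactExhaustion_quotScalar`; then ★ 2N-7 F3 `nonEllEstimates_of_weight`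
fed with ★ 2N-6 `locallyIntegrable_indicator_not_isCompact_centralizer_rpow_neg` (K2E3-p24 (g0), ψ-free) at `ε = 1∕16 < 1∕2`.
ROAD «GL₂-sc», NE half: 2N-0a∕0b∕0c∕0d (frame: exhaustion, dichotomy, fundamental domain ∕ Haar ∕ volume transfer, a.e. separability) · 2N-1 T18₂ · 2N-2 VOL₂ · 2N-3 T20₂ ·
2N-4 slice `hcanc` · 2N-5 ball (K2E3-p17 (g8)) · 2N-6 weight (K2E3-p24 (g0)) · 2N-7 coordinates ∕ cancellation ∕ assembly (this seat).
HONEST LABEL: HC_CM is proved only modulo the 7 printed citations (2 remaining named inputs: hLiu418 = stmt-HodgeConjecture-24832, h413 = stmt-HodgeConjecture-24833) until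
rung 0 closes; count-neutral helper; closes the hosted sub-socket (S-C′-GL₂sc-NE) only when the dealer ties it.

## References
* [HarishChandra1970] Harish-Chandra (notes by G. van Dijk), *Harmonic Analysis on Reductive p-adic Groups*, LNM 162 (1970), Part V §6 Thm 15 p. 63; Part VII §2 Thms 18–20 pp. 69–70, §3 pp. 70–73.
* [JacquetLanglands1970] H. Jacquet, R. P. Langlands, *Automorphic Forms on GL(2)*, LNM 114 (1970), §7 (characters of supercuspidal representations of `GL₂`).
-/

set_option autoImplicit false
-- the mandated namespace repeats the single-problem summit's segment (`HodgeConjecture.HodgeConjecture`)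
set_option linter.dupNamespace false

noncomputable section

open MeasureTheory Measure Set Filter Topology
open scoped MatrixGroups NNReal ENNReal WithZero
open Literature.NumberTheory.Automorphic Literature.NumberTheory.GaloisRepresentations Literature.NumberTheory.GaloisRepresentations.IsNonarchimedeanLocalField
open Summit.HodgeConjecture.HodgeConjecture.Cruxes.H413.K2E3GL2ModUniformizerNonEllEstimatesOfWeight (nonEllEstimates_of_weight)
open Summit.HodgeConjecture.HodgeConjecture.Cruxes.H413.K2E3GL2NonEllWeightLocIntegrable (locallyIntegrable_indicator_not_isCompact_centralizer_rpow_neg)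
open Summit.HodgeConjecture.HodgeConjecture.Cruxes.H413.K2E3GL2HeightBallExhaustion (exists_adHeightBall_compactExhaustion_quotScalar)
open Summit.HodgeConjecture.HodgeConjecture.Cruxes.H413.K2E3GL3ModUniformizerCocompact (compactSpace_units_quot_zpowers_uniformizer)

namespace Summit.HodgeConjecture.HodgeConjecture.Cruxes.H413.K2E3GL2ModUniformizerNonEllEstimates

/-- **HARISH-CHANDRA'S NON-ELLIPTIC ESTIMATES ON `G' = GL₂(F) ⧸ ϖ^ℤ` FOR A SUPERCUSPIDAL MATRIX COEFFICIENT** — the hosted sub-socket (S-C′-GL₂sc-NE)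
`U12Characters.sig_K2E3GL2ModUniformizerNonEllEstimates`, statement VERBATIM (= hypothesis `hNE₂` of ★ (2A-2) `charLocIntNear_gl2_supercuspidal_of_nonell`): for `F` a
characteristic-`0` non-archimedean local field with uniformizer `ϖ`, every Haar `μ` on `G'`, every smooth irreducible supercuspidal `r`, every `r`-invariant sesquilinear `B`
and every `v₁`, there are a compact exhaustion `Ω` of `G'` and `Fl`, `M` with: for `μ`-a.e. `g` with non-compact centraliser `∫_{Ω n} B v₁ (r(x g x⁻¹) v₁) → Fl g`; for
every `n`, a.e. `‖∫_{Ω n} …‖ ≤ M g`; and `M ∈ L¹_loc(μ)`.  ★ 2N-0a height-ball exhaustion ∘ ★ 2N-7 F3 `nonEllEstimates_of_weight` ∘ ★ 2N-6 (ψ-free weight).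
[cite: HarishChandra1970, Part V §6 Thm 15 p. 63; Part VII §2 Thms 18–20 pp. 69–70, §3 pp. 70–73] [cite: JacquetLanglands1970, §7] -/
theorem nonEllEstimates_modUniformizer :
  ∀ (F : Type) [Field F] [Valued F ℤᵐ⁰] [ValuativeRel F] [(Valued.v : Valuation F ℤᵐ⁰).Compatible] [IsNonarchimedeanLocalField F] [CharZero F]
    (ϖ : F) (hϖ : Valued.v ϖ = WithZero.exp (-1 : ℤ)) (hϖ0 : ϖ ≠ 0)
    [((Subgroup.zpowers (Units.mk0 ϖ hϖ0)).map (Matrix.GeneralLinearGroup.scalar (Fin 2))).Normal]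
    [MeasurableSpace (GL (Fin 2) F ⧸ (Subgroup.zpowers (Units.mk0 ϖ hϖ0)).map (Matrix.GeneralLinearGroup.scalar (Fin 2)))]
    [BorelSpace (GL (Fin 2) F ⧸ (Subgroup.zpowers (Units.mk0 ϖ hϖ0)).map (Matrix.GeneralLinearGroup.scalar (Fin 2)))]
    (μ : Measure (GL (Fin 2) F ⧸ (Subgroup.zpowers (Units.mk0 ϖ hϖ0)).map (Matrix.GeneralLinearGroup.scalar (Fin 2)))) [μ.IsHaarMeasure]
    (r : SmoothIrrep (GL (Fin 2) F ⧸ (Subgroup.zpowers (Units.mk0 ϖ hϖ0)).map (Matrix.GeneralLinearGroup.scalar (Fin 2)))), r.ρ.IsSupercuspidal →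
    ∀ (B : r.V →ₗ⋆[ℂ] r.V →ₗ[ℂ] ℂ),
      (∀ (g : GL (Fin 2) F ⧸ (Subgroup.zpowers (Units.mk0 ϖ hϖ0)).map (Matrix.GeneralLinearGroup.scalar (Fin 2))) (x y : r.V), B (r.ρ g x) (r.ρ g y) = B x y) →
    ∀ (v₁ : r.V),
      ∃ (Ω : CompactExhaustion (GL (Fin 2) F ⧸ (Subgroup.zpowers (Units.mk0 ϖ hϖ0)).map (Matrix.GeneralLinearGroup.scalar (Fin 2))))
        (Fl : (GL (Fin 2) F ⧸ (Subgroup.zpowers (Units.mk0 ϖ hϖ0)).map (Matrix.GeneralLinearGroup.scalar (Fin 2))) → ℂ)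
        (M : (GL (Fin 2) F ⧸ (Subgroup.zpowers (Units.mk0 ϖ hϖ0)).map (Matrix.GeneralLinearGroup.scalar (Fin 2))) → ℝ),
        (∀ᵐ g ∂μ, ¬ IsCompact ((Subgroup.centralizer ({g} : Set (GL (Fin 2) F ⧸ (Subgroup.zpowers (Units.mk0 ϖ hϖ0)).map (Matrix.GeneralLinearGroup.scalar (Fin 2))))) :
            Set (GL (Fin 2) F ⧸ (Subgroup.zpowers (Units.mk0 ϖ hϖ0)).map (Matrix.GeneralLinearGroup.scalar (Fin 2)))) →
          Tendsto (fun n => ∫ x in Ω n, B v₁ (r.ρ (x * g * x⁻¹) v₁) ∂μ) atTop (𝓝 (Fl g))) ∧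
        (∀ n, ∀ᵐ g ∂μ, ¬ IsCompact ((Subgroup.centralizer ({g} : Set (GL (Fin 2) F ⧸ (Subgroup.zpowers (Units.mk0 ϖ hϖ0)).map (Matrix.GeneralLinearGroup.scalar (Fin 2))))) :
            Set (GL (Fin 2) F ⧸ (Subgroup.zpowers (Units.mk0 ϖ hϖ0)).map (Matrix.GeneralLinearGroup.scalar (Fin 2)))) →
          ‖∫ x in Ω n, B v₁ (r.ρ (x * g * x⁻¹) v₁) ∂μ‖ ≤ M g) ∧
        LocallyIntegrable M μ := by
  intro F _ _ _ _ _ _ ϖ hϖ hϖ0 _ _ _ μ _ r hsc B hBinv v₁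
  haveI : CompactSpace (Fˣ ⧸ Subgroup.zpowers (Units.mk0 ϖ hϖ0)) := compactSpace_units_quot_zpowers_uniformizer hϖ hϖ0
  obtain ⟨Ω, hmem, -, -, -, hK, -, -, -⟩ := exists_adHeightBall_compactExhaustion_quotScalar (Subgroup.zpowers (Units.mk0 ϖ hϖ0)) hϖ hϖ0
  exact ⟨Ω, nonEllEstimates_of_weight hϖ hϖ0 μ r hsc B hBinv v₁ Ω hmem hK
    (fun δ _ hδ => locallyIntegrable_indicator_not_isCompact_centralizer_rpow_neg hϖ hϖ0 μ δ hδ (by norm_num) (by norm_num))⟩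

end Summit.HodgeConjecture.HodgeConjecture.Cruxes.H413.K2E3GL2ModUniformizerNonEllEstimates

end
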